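import Mathlib
import Summits.PneNP.PneNP.Theses.AeaCutRectangles
import Summits.PneNP.PneNP.Theorems.AeaCutRectanglesDutyRectangles

/-!
# Crux-triage round 2, seat 1 (TRIAGE-r2-1.md) — kernel checks on typed objects of the six round-2 idea cards
# (crux `FoolingMeasure`, stmt-PneNP-19727, route AeaCutRectangles)

FRONTIER restricted-model rung (AEA cut rectangles vs NON-3-COL).  Nothing here bears on P vs NP, which is NOT
proved.  The definitions below are mirrored VERBATIM from the companions `Cruxes/FoolingMeasure/IdeasR2g9s1.lean`
(§2: `fibreCore`, `mass`, `GeometricThinning`) and `Cruxes/FoolingMeasure/IdeasR2s2g7.lean` (§2–§3: `CycleSystem`,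
`Normal`, `edges`, `CayleyCliqueThreshold`, `pred`, `linkType`, `TwoSidedClass`, `TwoSidedDark`), because Cruxes files
are not importable on the farm.

* §A (`fibre-thinning`): `GeometricThinning μ B θ d` quantifies over ALL column families inside `B`; the complete
  loopless column `insideB B` (`|B| ≥ 4`, hence non-3-colourable) is compatible with every row, so the core of every
  fibre relative to `{insideB B}` IS the fibre and the hypothesis reads `fibre ≤ θ · fibre`.  Consequently, for
  `θ < 1`, every fibre `β₀` with `d + |β₀| ≤ C(|B|,2)` is `μ`-null (`geometricThinning_null_fibre`), and NO probability
  measure whose support members have `≤ C(|B|,2) - d` loopless edges inside `B` (e.g. every `2t`-regular support at a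
  cut with `|B| ≥ n/4`, `n` large) satisfies it (`not_geometricThinning_of_sparse_support`).  The hypothesis set of the
  card's `ThinningReduction` (which forces `θ < 1`) is therefore never met by `μ_t`: the reduction is vacuous as typed.
* §B (`two-sided-link-ladder`): `TwoSidedDark q t` quantifies over ALL cuts and does not ask `S, S'` to be support
  members (non-3-colourable).  At `B = univ` it says: every normal system with an aligned, edge-distinct normal partner
  is non-3-colourable (`twoSidedDark_univ`); the toy instance `q = t = 1` is refuted outright
  (`not_twoSidedDark_one_one`).  (`cayley-clique-model`: the free constant of `CayleyCliqueThreshold C` matters —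
  `C = 0` is false, `not_cayleyCliqueThreshold_zero`; `C = 1` is false by the card's own table `S_D(16) = ∅`.)
-/

set_option linter.dupNamespace false

namespace Summit.PneNP.PneNP.Cruxes.FoolingMeasure.TriageR2s1

open Finset
open Summit.PneNP.PneNP.Theorems.AeaCutRectanglesDutyRectangles (aliceSide bobSide mem_aliceSide mem_bobSide)

/-- 3-colourability of the graph spanned by an edge set over `Fin n` (as in the route file). -/
abbrev Col3 {n : ℕ} (G : Finset (Sym2 (Fin n))) : Prop :=
  (SimpleGraph.fromEdgeSet (G : Set (Sym2 (Fin n)))).Colorable 3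

/-! ## §A  `GeometricThinning` is unsatisfiable for `θ < 1` (mirror of `IdeasR2g9s1` §2) -/

section fibre

variable {n : ℕ}

open Classical in
/-- VERBATIM mirror of `IdeasR2g9s1.fibreCore`. -/
noncomputable def fibreCore (B : Finset (Fin n)) (𝓑 : Finset (Finset (Sym2 (Fin n)))) (β : Finset (Sym2 (Fin n))) :
    Finset (Finset (Sym2 (Fin n))) :=
  univ.filter fun G => bobSide B G = β ∧ ∀ β' ∈ 𝓑, ¬ Col3 (aliceSide B G ∪ β')

open Classical in
/-- VERBATIM mirror of `IdeasR2g9s1.mass`. -/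
noncomputable def mass (μ : Finset (Sym2 (Fin n)) → ℝ) (𝓕 : Finset (Finset (Sym2 (Fin n)))) : ℝ := ∑ G ∈ 𝓕, μ G

open Classical in
/-- VERBATIM mirror of `IdeasR2g9s1.GeometricThinning`. -/
def GeometricThinning (μ : Finset (Sym2 (Fin n)) → ℝ) (B : Finset (Fin n)) (θ : ℝ) (d : ℕ) : Prop :=
  ∀ β₀ : Finset (Sym2 (Fin n)), ∀ 𝓑 : Finset (Finset (Sym2 (Fin n))),
    (∀ β ∈ 𝓑, ∀ e ∈ β, ¬ e.IsDiag ∧ ∀ v ∈ e, v ∈ B) →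
    (∀ β ∈ 𝓑, ∀ β' ∈ 𝓑, β ≠ β' → d ≤ (symmDiff β β').card) → (∀ β ∈ 𝓑, d ≤ (symmDiff β β₀).card) →
    mass μ (fibreCore B 𝓑 β₀) ≤ θ ^ 𝓑.card * mass μ (univ.filter fun G => bobSide B G = β₀)

open Classical in
/-- The complete loopless column on `B`: all non-diagonal pairs inside `B`. -/
noncomputable def insideB (B : Finset (Fin n)) : Finset (Sym2 (Fin n)) :=
  univ.filter fun e => ¬ e.IsDiag ∧ ∀ v ∈ e, v ∈ B

/-- For `|B| ≥ 4` the complete column on `B` contains a `K₄`, hence is not 3-colourable. -/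
theorem not_col3_insideB {B : Finset (Fin n)} (hB : 4 ≤ B.card) : ¬ Col3 (insideB B) := by
  classical
  intro hcol
  obtain ⟨s, hsB, hs⟩ := Finset.exists_subset_card_eq hB
  have hcf := hcol.cliqueFree (by norm_num : 3 < 4)
  refine hcf s ⟨?_, hs⟩
  intro u hu v hv huv
  rw [SimpleGraph.fromEdgeSet_adj]
  refine ⟨?_, huv⟩
  rw [Finset.mem_coe]
  simp only [insideB, mem_filter, mem_univ, true_and, Sym2.mk_isDiag_iff]
  refine ⟨huv, fun w hw => ?_⟩
  rcases Sym2.mem_iff.1 hw with rfl | rfl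
  · exact hsB hu
  · exact hsB hv

/-- A non-3-colourable column is compatible with EVERY row: relative to `{β'}` the core of any fibre is the fibre. -/
theorem fibreCore_singleton_eq (B : Finset (Fin n)) {β' : Finset (Sym2 (Fin n))} (hβ' : ¬ Col3 β')
    (β₀ : Finset (Sym2 (Fin n))) :
    fibreCore B {β'} β₀ = univ.filter fun G => bobSide B G = β₀ := by
  classical
  ext G
  simp only [fibreCore, mem_filter, mem_univ, true_and, mem_singleton, forall_eq]
  constructor
  · exact fun h => h.1
  · intro h
    refine ⟨h, fun hcol => hβ' ?_⟩
    exact hcol.mono_left (SimpleGraph.fromEdgeSet_mono (Finset.coe_subset.2 subset_union_right))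

/-- `GeometricThinning` with `θ < 1` forces every fibre `β₀ ⊆ insideB B` with `d + |β₀| ≤ |insideB B|` to be null. -/
theorem geometricThinning_null_fibre {μ : Finset (Sym2 (Fin n)) → ℝ} {B : Finset (Fin n)} {θ : ℝ} {d : ℕ}
    (hGT : GeometricThinning μ B θ d) (hθ : θ < 1) (hμ : ∀ S, 0 ≤ μ S) (hB : 4 ≤ B.card)
    (β₀ : Finset (Sym2 (Fin n))) (hβ₀ : β₀ ⊆ insideB B) (hroom : d + β₀.card ≤ (insideB B).card) :
    mass μ (univ.filter fun G => bobSide B G = β₀) = 0 := by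
  classical
  have h1 := hGT β₀ {insideB B} ?_ ?_ ?_
  · rw [fibreCore_singleton_eq B (not_col3_insideB hB), card_singleton, pow_one] at h1
    have hm : 0 ≤ mass μ (univ.filter fun G => bobSide B G = β₀) := by
      unfold mass; exact sum_nonneg fun G _ => hμ G
    have hm0 : mass μ (univ.filter fun G => bobSide B G = β₀) ≤ 0 := by
      by_contra hlt
      push Not at hlt
      have := mul_pos (sub_pos.mpr hθ) hlt
      nlinarith
    exact le_antisymm hm0 hm
  · intro β hβ e he
    rw [mem_singleton] at hβ
    subst hβ
    simpa [insideB] using he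
  · intro β hβ β' hβ' hne
    rw [mem_singleton] at hβ hβ'
    exact absurd (hβ.trans hβ'.symm) hne
  · intro β hβ
    rw [mem_singleton] at hβ
    subst hβ
    have : symmDiff (insideB B) β₀ = insideB B \ β₀ := by
      rw [symmDiff_def, Finset.sdiff_eq_empty_iff_subset.mpr hβ₀]
      simp
    rw [this, card_sdiff_of_subset hβ₀]
    omega

/-- **`GeometricThinning` (θ < 1) is refuted for every probability measure with sparse insides.**  If `μ ≥ 0`,
`∑ μ = 1`, `|B| ≥ 4` and every support member is loopless with at most `|insideB B| - d` edges inside `B`, then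
`GeometricThinning μ B θ d` fails for every `θ < 1`.  (For `μ_t`: members are `2t`-regular, so `|bobSide| ≤ t·n`,
while `|insideB B| = C(|B|,2) ≥ C(n/4, 2)`; the hypothesis holds for all large `n` and all `d ≤ n / log₂ n`.) -/
theorem not_geometricThinning_of_sparse_support {μ : Finset (Sym2 (Fin n)) → ℝ} {B : Finset (Fin n)} {θ : ℝ}
    {d : ℕ} (hθ : θ < 1) (hμ : ∀ S, 0 ≤ μ S) (hμ1 : ∑ S, μ S = 1) (hB : 4 ≤ B.card)
    (hsupp : ∀ G, μ G ≠ 0 → (∀ e ∈ G, ¬ e.IsDiag) ∧ d + (bobSide B G).card ≤ (insideB B).card) :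
    ¬ GeometricThinning μ B θ d := by
  classical
  intro hGT
  have hzero : ∀ G, μ G = 0 := by
    intro G
    by_contra hG
    obtain ⟨hloop, hroom⟩ := hsupp G hG
    have hβ₀ : bobSide B G ⊆ insideB B := by
      intro e he
      rw [mem_bobSide] at he
      simp only [insideB, mem_filter, mem_univ, true_and]
      exact ⟨hloop e he.1, he.2⟩
    have hnull := geometricThinning_null_fibre hGT hθ hμ hB (bobSide B G) hβ₀ hroom
    have hGmem : G ∈ (univ.filter fun G' => bobSide B G' = bobSide B G) := by simp
    have hle : μ G ≤ mass μ (univ.filter fun G' => bobSide B G' = bobSide B G) := by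
      unfold mass; exact single_le_sum (fun G' _ => hμ G') hGmem
    rw [hnull] at hle
    exact hG (le_antisymm hle (hμ G))
  have : ∑ S, μ S = 0 := sum_eq_zero fun S _ => hzero S
  linarith

end fibre

/-! ## §B  `TwoSidedDark` at the degenerate cut `B = univ`; `CayleyCliqueThreshold 0` (mirror of `IdeasR2s2g7`) -/

/-- VERBATIM mirror of `IdeasR2s2g7.CycleSystem`. -/
structure CycleSystem (q t : ℕ) where
  pos : Fin t → Equiv.Perm (Fin (3 * q + 1))

namespace CycleSystem

variable {q t : ℕ} (S : CycleSystem q t)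

/-- successor of `v` along cycle `k` (mirror). -/
def succ (k : Fin t) (v : Fin (3 * q + 1)) : Fin (3 * q + 1) := (S.pos k).symm (S.pos k v + 1)

/-- the graph of the system (mirror). -/
def edges : Finset (Sym2 (Fin (3 * q + 1))) :=
  (Finset.univ : Finset (Fin t × Fin (3 * q + 1))).image fun p => s(p.2, S.succ p.1 p.2)

/-- NORMALITY (mirror). -/
def Normal : Prop :=
  ∀ i k : Fin t, i ≠ k → ∀ v : Fin (3 * q + 1), (S.pos i (S.succ k v) - S.pos i v).val % 3 = 2

end CycleSystem

variable {q t : ℕ}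

/-- mirror of `IdeasR2s2g7.CayleyCliqueThreshold`. -/
def CayleyCliqueThreshold (C : ℕ) : Prop :=
  ∀ q t : ℕ, C * 3 ^ t ≤ 3 * q + 1 → ∃ S : CycleSystem q t, S.Normal

/-- mirror of `IdeasR2s2g7.pred`. -/
def pred (S : CycleSystem q t) (k : Fin t) (v : Fin (3 * q + 1)) : Fin (3 * q + 1) :=
  (S.pos k).symm (S.pos k v - 1)

/-- mirror of `IdeasR2s2g7.linkType`. -/
def linkType (S : CycleSystem q t) (B : Finset (Fin (3 * q + 1))) (k : Fin t) (v : Fin (3 * q + 1)) :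
    Bool × Bool :=
  (decide (pred S k v ∈ B), decide (S.succ k v ∈ B))

/-- mirror of `IdeasR2s2g7.TwoSidedClass`. -/
def TwoSidedClass (S : CycleSystem q t) (B : Finset (Fin (3 * q + 1))) : Set (CycleSystem q t) :=
  {S' | (∀ k v, (S'.pos k v).val % 3 = (S.pos k v).val % 3) ∧ ∀ k, ∀ v ∈ B, linkType S' B k v = linkType S B k v}

/-- VERBATIM mirror of `IdeasR2s2g7.TwoSidedDark`. -/
def TwoSidedDark (q t : ℕ) : Prop :=
  ∀ (S S' : CycleSystem q t) (B : Finset (Fin (3 * q + 1))), S.Normal → S'.Normal → S' ∈ TwoSidedClass S B →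
    S'.edges ≠ S.edges → ¬ Col3 (aliceSide B S.edges ∪ bobSide B S'.edges)

theorem aliceSide_univ {m : ℕ} (G : Finset (Sym2 (Fin m))) : aliceSide univ G = ∅ := by
  ext e; simp [mem_aliceSide]

theorem bobSide_univ {m : ℕ} (G : Finset (Sym2 (Fin m))) : bobSide univ G = G := by
  ext e; simp [mem_bobSide]

/-- **`TwoSidedDark` at `B = univ`.**  The typed darkness hypothesis forces every normal system `S'` that has an
aligned normal partner `S` with different edge set to be NON-3-colourable — it quantifies over all cuts (here the
trivial one, where Alice holds nothing and the link condition is automatic) and never asks `S, S'` to be support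
members.  Any 3-colourable normal system with such a partner (e.g. a 3-colourable normal circulant relabelled by a
non-automorphism preserving the joint residue classes) refutes it. -/
theorem twoSidedDark_univ (h : TwoSidedDark q t) {S S' : CycleSystem q t} (hS : S.Normal) (hS' : S'.Normal)
    (hal : ∀ k v, (S'.pos k v).val % 3 = (S.pos k v).val % 3) (hne : S'.edges ≠ S.edges) : ¬ Col3 S'.edges := by
  have hmem : S' ∈ TwoSidedClass S univ := ⟨hal, fun k v _ => by simp [linkType]⟩
  have := h S S' univ hS hS' hmem hne
  rwa [aliceSide_univ, bobSide_univ, empty_union] at this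

section toy

/-- every `1`-system is normal (the condition quantifies over pairs of distinct rulers). -/
theorem normal_of_one (S : CycleSystem q 1) : S.Normal := by
  intro i k hik
  exact absurd (Subsingleton.elim i k) hik

/-- the identity ruler on `Fin 4` (`q = t = 1`): the 4-cycle `0-1-2-3-0`. -/
def idSys : CycleSystem 1 1 := ⟨fun _ => Equiv.refl _⟩

/-- positions of `idSys` with the positions of the vertices `0` and `3` exchanged (same residues mod 3). -/
def swap03 : Equiv.Perm (Fin (3 * 1 + 1)) where
  toFun := ![3, 1, 2, 0]
  invFun := ![3, 1, 2, 0]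
  left_inv := by decide
  right_inv := by decide

/-- the relabelled ruler: the 4-cycle `3-1-2-0-3`. -/
def swapSys : CycleSystem 1 1 := ⟨fun _ => swap03⟩

theorem swapSys_aligned : ∀ k v, (swapSys.pos k v).val % 3 = (idSys.pos k v).val % 3 := by decide

theorem swapSys_edges_ne : swapSys.edges ≠ idSys.edges := by decide

/-- a proper 2-colouring of the 4-cycle `3-1-2-0-3`. -/
def toyColour : Fin (3 * 1 + 1) → Fin 3 := ![0, 0, 1, 1]

theorem swapSys_col3 : Col3 swapSys.edges := by
  have key : ∀ v w : Fin (3 * 1 + 1), s(v, w) ∈ swapSys.edges → v ≠ w → toyColour v ≠ toyColour w := by decide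
  exact ⟨SimpleGraph.Coloring.mk toyColour fun {v w} hadj => by
    rw [SimpleGraph.fromEdgeSet_adj, Finset.mem_coe] at hadj
    exact key v w hadj.1 hadj.2⟩

/-- **The toy instance `q = t = 1` of the typed darkness statement is false.** -/
theorem not_twoSidedDark_one_one : ¬ TwoSidedDark 1 1 := fun h =>
  twoSidedDark_univ h (normal_of_one idSys) (normal_of_one swapSys) swapSys_aligned swapSys_edges_ne swapSys_col3

/-- **`CayleyCliqueThreshold 0` is false** (`q = 0`, `t = 2`: no normal 2-system on one vertex). -/
theorem not_cayleyCliqueThreshold_zero : ¬ CayleyCliqueThreshold 0 := by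
  intro h
  obtain ⟨S, hS⟩ := h 0 2 (by norm_num)
  have hx : ∀ x : Fin (3 * 0 + 1), x.val % 3 ≠ 2 := by decide
  exact hx _ (hS 0 1 (by decide) 0)

end toy

end Summit.PneNP.PneNP.Cruxes.FoolingMeasure.TriageR2s1
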